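import Summits.NavierStokesRegularity.NavierStokesRegularity.Theorems.ExtremiserTransienceWeakClassPressureSource
import Literature.Analysis.FluidPDE.RieszPressureModConst
import HarnessLib

/-!
# Route `ExtremiserTransience`, LINE g5-α repair (seat ns-idea-5 g5): Type-I oscillation bound for the Riesz pressure of weak-class fields

`--supports stmt-NavierStokesRegularity-27823` (the subcubic local energy budget, p639422) — the pressure ingredient of recipe step 4 (line card
§RECIPE) in ready form.  Route-independent module.  For a member `(W, K)` of the weak one-slice class there are `A₁, A₂ ≥ 0` with
`|Q̃_σ(x) − Q̃_σ(x')| ≤ A₁/σ² + (A₂/(−σ)) √(1 + ‖x − x'‖)` for all `σ < 0` and all `x₀, x, x'`, where `Q̃_σ = pressurePotentialMod x₀ (W σ)` is the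
Riesz pressure modulo constants (Seregin 2014, Lemma 6.5, the tree's `exists_abs_pressurePotentialMod_sub_le`: `2N_G∫|Γ₀| + A N² √(1+|x−x'|)`), fed
with the Type-I bounds `N = K/√(−σ)` and `N_G = K_G/σ²` (`weakClass_pressureSourceTypeI`, p639898).  In the local energy identity on `B_{2ρ} × (t₀−ρ², t₀)`
this makes the pressure flux `O(ρ^{5/2})` (§RECIPE step 4), which is subcubic and hence enough for 27823 (`plateauSliceRigidity_of_budget'`).
HONEST FRAMING: regularity bookkeeping for hypothetical blow-up limits; nothing about Navier–Stokes regularity or blow-up is proved here and no summit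
is proved by a line. [cite: Seregin2014, §6.2 Lemma 6.5]
-/

noncomputable section

namespace Summit.NavierStokesRegularity.NavierStokesRegularity.Theorems.ExtremiserTransience
set_option linter.dupNamespace false

open Set Function MeasureTheory Filter Topology
open scoped RealInnerProductSpace ContDiff
open Literature.Analysis Literature.Analysis.FluidPDE

/-- **Type-I oscillation of the Riesz pressure modulo constants** of a weak-class field. [cite: Seregin2014, §6.2 Lemma 6.5] -/
theorem weakClass_pressureOsc (W : ℝ → EuclideanSpace ℝ (Fin 3) → EuclideanSpace ℝ (Fin 3)) (K : ℝ)
    (hcont : ContinuousOn (Function.uncurry W) (Set.Iio (0 : ℝ) ×ˢ Set.univ))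
    (hmild : ∀ s t : ℝ, s < t → t < 0 → ∀ x, W t x =
      Literature.Analysis.FluidPDE.heatFlow (W s) (t - s) x - Literature.Analysis.FluidPDE.oseenDuhamel 1 s W W t x)
    (hdec : ∀ t : ℝ, t < 0 → ∀ x, Real.sqrt (-t) * ‖W t x‖ ≤ K) :
    ∃ A₁ A₂ : ℝ, 0 ≤ A₁ ∧ 0 ≤ A₂ ∧ ∀ σ < 0, ∀ x₀ x x' : EuclideanSpace ℝ (Fin 3),
      |pressurePotentialMod x₀ (W σ) x - pressurePotentialMod x₀ (W σ) x'| ≤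
        A₁ / σ ^ 2 + A₂ / (-σ) * Real.sqrt (1 + ‖x - x'‖) := by
  obtain ⟨A, hA0, hA⟩ := exists_abs_pressurePotentialMod_sub_le
  obtain ⟨KG, hKG, hG⟩ := weakClass_pressureSourceTypeI W K hcont hmild hdec
  obtain ⟨K₁, -, hg⟩ := weakClass_gradTypeI W K hcont hmild hdec
  have hΓ : 0 ≤ ∫ z, |newtonNear 1 2 z| := integral_nonneg fun z => abs_nonneg _
  refine ⟨2 * KG * ∫ z, |newtonNear 1 2 z|, A * K ^ 2, by positivity, by positivity, fun σ hσ x₀ x x' => ?_⟩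
  have hσ0 : (0:ℝ) < -σ := by linarith
  have hsq : 0 < Real.sqrt (-σ) := Real.sqrt_pos.2 hσ0
  have hσ2 : 0 < σ ^ 2 := sq_pos_of_neg hσ
  have hcW : Continuous (W σ) := (hg σ hσ).1.continuous
  have hN : ∀ y, ‖W σ y‖ ≤ K / Real.sqrt (-σ) := fun y => by
    rw [le_div_iff₀ hsq, mul_comm]; exact hdec σ hσ y
  have hNG : ∀ y, |pressureSource (W σ) y| ≤ KG / σ ^ 2 := fun y => by
    rw [le_div_iff₀ hσ2, mul_comm]; exact hG σ hσ y
  have h := hA (W σ) hcW (K / Real.sqrt (-σ)) (KG / σ ^ 2) hN hNG x₀ x x'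
  have e1 : 2 * (KG / σ ^ 2) * (∫ z, |newtonNear 1 2 z|) = (2 * KG * ∫ z, |newtonNear 1 2 z|) / σ ^ 2 := by ring
  have e2 : A * (K / Real.sqrt (-σ)) ^ 2 * Real.sqrt (1 + ‖x - x'‖) = A * K ^ 2 / (-σ) * Real.sqrt (1 + ‖x - x'‖) := by
    rw [div_pow, Real.sq_sqrt hσ0.le]; ring
  rw [e1, e2] at h
  exact h

end Summit.NavierStokesRegularity.NavierStokesRegularity.Theorems.ExtremiserTransience

end
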